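import Mathlib
import HarnessLib
import Summits.KontsevichZagierPeriods.Zeta5Search.Denom.KernelStripStep
import Summits.KontsevichZagierPeriods.Zeta5Search.Denom.KernelSechSq
import Summits.KontsevichZagierPeriods.Zeta5Search.Denom.KernelResidueStep

/-!
# Zudilin 2014, Lemma 1 in the kernel: `(1/2πi)∫_{½−i∞}^{½+i∞} (π/sin πt)² P_ℓ(t) dt = (−1)^ℓ/(ℓ+1)`

HONEST FRAMING: systematic search; no irrationality claim unless certified.  Pure complex analysis; no
arithmetic and no claim about any zeta value is made here.

For the binomial polynomials `P_ℓ(t) = (t−1)(t−2)⋯(t−ℓ)/ℓ!` (`barnesP ℓ`), [Zudilin2014ZetaTwo, Lemma 1]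
(arXiv:1310.1526, p. 4; proved there from Barnes's first lemma) states
`(1/2πi)∫_{½−i∞}^{½+i∞} (π/sin πt)² P_ℓ(t) dt = (−1)^ℓ/(ℓ+1)`, `ℓ = 0, 1, 2, …`; it supplies the term
`Σ_ℓ (−1)^{d+ℓ} A_ℓ/(ℓ+1)` of `p(a,b)` in Proposition 1 (`Literature…Zudilin2014.formP`).  Here it is PROVED
by residues instead of Barnes: on the line `Re t = ½` the kernel is `π²/cosh²(πy)`
(`KernelSechSq.kernel_halfLine`), and one application of the residue step
(`KernelResidueStep.integral_kernel_residue_step`, pole `m = 0`) to `g(t) = P_{ℓ+1}(t+1)` together with the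
Pascal rule `P_{ℓ+1}(s+1) = P_{ℓ+1}(s) + P_ℓ(s)` and `g′(0) = P′_{ℓ+1}(1) = (−1)^ℓ/(ℓ+1)` gives
`J(ℓ+1) = J(ℓ+1) + J(ℓ) − 2π(−1)^ℓ/(ℓ+1)`, i.e. `J(ℓ) = 2π(−1)^ℓ/(ℓ+1)` for the profile moments
`J(ℓ) = ∫_ℝ π²/cosh²(πy) · P_ℓ(½+iy) dy` (`kernelMoment_eq`); the printed form is `barnes_lemma_one`.
-/

noncomputable section

open Complex Set MeasureTheory Filter Topology Finset
open Summit.KontsevichZagierPeriods.Zeta5Search.Denom.KernelStripStep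
open Summit.KontsevichZagierPeriods.Zeta5Search.Denom.KernelSechSq
open Summit.KontsevichZagierPeriods.Zeta5Search.Denom.KernelResidueStep

namespace Summit.KontsevichZagierPeriods.Zeta5Search.Denom.KernelBinomialMoment

/-! ### Falling factorials and the binomial polynomials `P_ℓ` -/

/-- The falling factorial `t(t−1)⋯(t−n+1)` over `ℂ`. -/
def fallC (n : ℕ) (t : ℂ) : ℂ := ∏ j ∈ range n, (t - j)

/-- **`P_ℓ(t) = (t−1)(t−2)⋯(t−ℓ)/ℓ!`** [Zudilin2014ZetaTwo, Lemma 1]. -/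
def barnesP (ℓ : ℕ) (t : ℂ) : ℂ := fallC ℓ (t - 1) / (Nat.factorial ℓ : ℂ)

/-- `fallC 0 = 1`. -/
@[simp] theorem fallC_zero (t : ℂ) : fallC 0 t = 1 := by simp [fallC]

/-- `fallC (n+1) t = fallC n t · (t − n)`. -/
theorem fallC_succ_right (n : ℕ) (t : ℂ) : fallC (n + 1) t = fallC n t * (t - n) :=
  prod_range_succ _ _

/-- `fallC (n+1) t = t · fallC n (t − 1)`. -/
theorem fallC_succ_left (n : ℕ) (t : ℂ) : fallC (n + 1) t = t * fallC n (t - 1) := by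
  rw [fallC, prod_range_succ', fallC, mul_comm]
  simp only [Nat.cast_zero, sub_zero, Nat.cast_succ]
  congr 1
  exact prod_congr rfl fun j _ => by ring

/-- **Pascal's rule** for falling factorials: `fallC (n+1) s = fallC (n+1) (s−1) + (n+1)·fallC n (s−1)`. -/
theorem fallC_pascal (n : ℕ) (s : ℂ) :
    fallC (n + 1) s = fallC (n + 1) (s - 1) + (n + 1) * fallC n (s - 1) := by
  rw [fallC_succ_left, fallC_succ_right n (s - 1)]
  ring

/-- `fallC n (−1) = (−1)^n · n!`. -/
theorem fallC_neg_one (n : ℕ) : fallC n (-1) = (-1) ^ n * (Nat.factorial n : ℂ) := by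
  induction n with
  | zero => simp
  | succ n ih =>
    rw [fallC_succ_right, ih, Nat.factorial_succ]
    push_cast
    ring

/-- **Pascal's rule** `P_{ℓ+1}(s+1) = P_{ℓ+1}(s) + P_ℓ(s)`. -/
theorem barnesP_pascal (ℓ : ℕ) (s : ℂ) : barnesP (ℓ + 1) (s + 1) = barnesP (ℓ + 1) s + barnesP ℓ s := by
  simp only [barnesP, add_sub_cancel_right]
  rw [fallC_pascal ℓ s, Nat.factorial_succ]
  have h : (Nat.factorial ℓ : ℂ) ≠ 0 := by exact_mod_cast (Nat.factorial_pos ℓ).ne'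
  push_cast
  field_simp

/-- `fallC n` is entire. -/
@[fun_prop]
theorem differentiable_fallC (n : ℕ) : Differentiable ℂ (fallC n) := by
  unfold fallC
  fun_prop

/-- `P_ℓ` is entire. -/
@[fun_prop]
theorem differentiable_barnesP (ℓ : ℕ) : Differentiable ℂ (barnesP ℓ) := by
  unfold barnesP
  fun_prop

/-- `P_ℓ` is continuous. -/
@[fun_prop]
theorem continuous_barnesP (ℓ : ℕ) : Continuous (barnesP ℓ) := (differentiable_barnesP ℓ).continuous

/-- `(d/dt) P_{ℓ+1}(t+1) |_{t=0} = (−1)^ℓ/(ℓ+1)` (a simple zero of `P_{ℓ+1}(t+1) = t(t−1)⋯(t−ℓ)/(ℓ+1)!`). -/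
theorem hasDerivAt_barnesP_succ_shift (ℓ : ℕ) :
    HasDerivAt (fun t : ℂ => barnesP (ℓ + 1) (t + 1)) ((-1) ^ ℓ / (ℓ + 1)) 0 := by
  have hfun : (fun t : ℂ => barnesP (ℓ + 1) (t + 1)) =
      fun t => t * fallC ℓ (t - 1) / (Nat.factorial (ℓ + 1) : ℂ) := by
    funext t
    simp only [barnesP, add_sub_cancel_right, fallC_succ_left]
  rw [hfun]
  have hd : HasDerivAt (fun t : ℂ => fallC ℓ (t - 1)) (deriv (fun t : ℂ => fallC ℓ (t - 1)) 0) 0 :=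
    (by fun_prop : Differentiable ℂ fun t : ℂ => fallC ℓ (t - 1)).differentiableAt.hasDerivAt
  have h := ((hasDerivAt_id' (0 : ℂ)).mul hd).div_const (Nat.factorial (ℓ + 1) : ℂ)
  refine h.congr_deriv ?_
  rw [zero_sub, fallC_neg_one, Nat.factorial_succ]
  have hf : (Nat.factorial ℓ : ℂ) ≠ 0 := by exact_mod_cast (Nat.factorial_pos ℓ).ne'
  push_cast
  field_simp
  ring

/-! ### Growth of `P_ℓ` on vertical strips -/

/-- `‖fallC n t‖ ≤ ((R + n)(1 + |Im t|))^n` when `|Re t| ≤ R`. -/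
theorem norm_fallC_le {t : ℂ} {R : ℝ} (hR0 : 0 ≤ R) (hR : |t.re| ≤ R) (n : ℕ) :
    ‖fallC n t‖ ≤ ((R + n) * (1 + |t.im|)) ^ n := by
  induction n with
  | zero => simp
  | succ n ih =>
    rw [fallC_succ_right, norm_mul]
    have ha : 0 ≤ |t.im| := abs_nonneg _
    have h1 : ‖t - (n : ℂ)‖ ≤ R + n + |t.im| := by
      refine (norm_le_abs_re_add_abs_im _).trans ?_
      rw [sub_re, sub_im, natCast_re, natCast_im, sub_zero]
      have : |t.re - n| ≤ |t.re| + n := by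
        calc |t.re - n| ≤ |t.re| + |(n : ℝ)| := abs_sub _ _
          _ = |t.re| + n := by rw [Nat.abs_cast]
      linarith
    have h2 : R + n + |t.im| ≤ (R + (n + 1 : ℕ)) * (1 + |t.im|) := by
      push_cast
      nlinarith
    have h3 : ((R + n) * (1 + |t.im|)) ^ n ≤ ((R + (n + 1 : ℕ)) * (1 + |t.im|)) ^ n := by
      apply pow_le_pow_left₀ (by positivity)
      push_cast
      nlinarith
    calc ‖fallC n t‖ * ‖t - (n : ℂ)‖ ≤ ((R + n) * (1 + |t.im|)) ^ n * (R + n + |t.im|) :=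
          mul_le_mul ih h1 (norm_nonneg _) (by positivity)
      _ ≤ ((R + (n + 1 : ℕ)) * (1 + |t.im|)) ^ n * ((R + (n + 1 : ℕ)) * (1 + |t.im|)) :=
          mul_le_mul h3 h2 (by positivity) (by positivity)
      _ = ((R + (n + 1 : ℕ)) * (1 + |t.im|)) ^ (n + 1) := by rw [pow_succ]

/-- `1 + |y| ≤ 2(1 + y²)`. -/
theorem one_add_abs_le_two_mul_sq (y : ℝ) : 1 + |y| ≤ 2 * (1 + y ^ 2) := by
  nlinarith [sq_nonneg (|y| - 1), sq_abs y, abs_nonneg y]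

/-- Polynomial growth of `fallC n` on a strip `|Re t| ≤ R`: `‖fallC n t‖ ≤ (2(R+n))^n (1 + (Im t)²)^n`. -/
theorem norm_fallC_le_sq {t : ℂ} {R : ℝ} (hR0 : 0 ≤ R) (hR : |t.re| ≤ R) (n : ℕ) :
    ‖fallC n t‖ ≤ (2 * (R + n)) ^ n * (1 + t.im ^ 2) ^ n := by
  refine (norm_fallC_le hR0 hR n).trans ?_
  rw [← mul_pow]
  apply pow_le_pow_left₀ (by positivity)
  nlinarith [one_add_abs_le_two_mul_sq t.im, show (0 : ℝ) ≤ R + n by positivity]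

/-- Division by `ℓ!` does not increase the norm. -/
theorem norm_div_factorial_le (z : ℂ) (ℓ : ℕ) : ‖z / (Nat.factorial ℓ : ℂ)‖ ≤ ‖z‖ := by
  rw [norm_div, Complex.norm_natCast]
  exact div_le_self (norm_nonneg _) (by exact_mod_cast Nat.one_le_iff_ne_zero.mpr (Nat.factorial_ne_zero ℓ))

/-- Growth of `P_{ℓ+1}(t+1)` on `halfStrip 0`. -/
theorem norm_barnesP_succ_shift_le (ℓ : ℕ) :
    ∀ t ∈ halfStrip 0, ‖barnesP (ℓ + 1) (t + 1)‖ ≤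
      (2 * (1 / 2 + (ℓ + 1 : ℕ))) ^ (ℓ + 1) * (1 + t.im ^ 2) ^ (ℓ + 1) := by
  intro t ht
  simp only [halfStrip, Set.mem_preimage, Set.mem_Icc, Int.cast_zero, zero_sub, zero_add] at ht
  have hre : |t.re| ≤ 1 / 2 := abs_le.2 ⟨by linarith [ht.1], ht.2⟩
  simp only [barnesP, add_sub_cancel_right]
  exact (norm_div_factorial_le _ _).trans (norm_fallC_le_sq (by norm_num) hre (ℓ + 1))

/-- Growth of `P_ℓ(½ + iy)` along the line. -/
theorem norm_barnesP_half_le (ℓ : ℕ) (y : ℝ) :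
    ‖barnesP ℓ (((1 / 2 : ℝ) : ℂ) + (y : ℂ) * I)‖ ≤ (2 * (1 / 2 + (ℓ : ℕ))) ^ ℓ * (1 + y ^ 2) ^ ℓ := by
  simp only [barnesP]
  have hre : |((((1 / 2 : ℝ) : ℂ) + (y : ℂ) * I) - 1).re| ≤ 1 / 2 := by
    simp only [sub_re, add_re, ofReal_re, mul_re, ofReal_im, I_re, I_im, one_re]
    norm_num
  have him : ((((1 / 2 : ℝ) : ℂ) + (y : ℂ) * I) - 1).im = y := by simp
  have h := norm_fallC_le_sq (by norm_num : (0 : ℝ) ≤ 1 / 2) hre ℓ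
  rw [him] at h
  exact (norm_div_factorial_le _ _).trans h

/-! ### The moments `J(ℓ) = ∫ π²/cosh²(πy) · P_ℓ(½ + iy) dy` -/

/-- The profile moment `J(ℓ) = ∫_ℝ π²/cosh²(πy) · P_ℓ(½ + iy) dy`. -/
def kernelMoment (ℓ : ℕ) : ℂ := ∫ y : ℝ, ((sechSq y : ℝ) : ℂ) * barnesP ℓ (((1 / 2 : ℝ) : ℂ) + (y : ℂ) * I)

/-- The integrand of `J(ℓ)` is integrable. -/
theorem integrable_kernelMoment (ℓ : ℕ) :
    Integrable fun y : ℝ => ((sechSq y : ℝ) : ℂ) * barnesP ℓ (((1 / 2 : ℝ) : ℂ) + (y : ℂ) * I) :=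
  integrable_sechSq_mul (by fun_prop) (norm_barnesP_half_le ℓ)

/-- **The moments in closed form: `J(ℓ) = 2π · (−1)^ℓ/(ℓ+1)`.** -/
theorem kernelMoment_eq (ℓ : ℕ) : kernelMoment ℓ = 2 * Real.pi * ((-1) ^ ℓ / (ℓ + 1)) := by
  have hg : DifferentiableOn ℂ (fun t : ℂ => barnesP (ℓ + 1) (t + 1)) (halfStrip 0) :=
    (by fun_prop : Differentiable ℂ fun t : ℂ => barnesP (ℓ + 1) (t + 1)).differentiableOn
  have step := integral_kernel_residue_step (m := 0) hg (norm_barnesP_succ_shift_le ℓ)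
  have kL : ∀ y : ℝ, ((Real.pi : ℂ) / Complex.sin (Real.pi *
      (((((0 : ℤ) : ℝ) - 1 / 2 : ℝ) : ℂ) + (y : ℂ) * I))) ^ 2 = ((sechSq y : ℝ) : ℂ) :=
    fun y => kernel_halfLine (cos_pi_mul_intCast_sub_half 0) y
  have kR : ∀ y : ℝ, ((Real.pi : ℂ) / Complex.sin (Real.pi *
      (((((0 : ℤ) : ℝ) + 1 / 2 : ℝ) : ℂ) + (y : ℂ) * I))) ^ 2 = ((sechSq y : ℝ) : ℂ) :=
    fun y => kernel_halfLine (cos_pi_mul_intCast_add_half 0) y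
  simp only [kL, kR] at step
  have eL : (fun y : ℝ => ((sechSq y : ℝ) : ℂ) *
      barnesP (ℓ + 1) ((((((0 : ℤ) : ℝ) - 1 / 2 : ℝ) : ℂ) + (y : ℂ) * I) + 1)) =
      fun y : ℝ => ((sechSq y : ℝ) : ℂ) * barnesP (ℓ + 1) (((1 / 2 : ℝ) : ℂ) + (y : ℂ) * I) := by
    funext y
    congr 2
    push_cast
    ring
  have eR : (fun y : ℝ => ((sechSq y : ℝ) : ℂ) *
      barnesP (ℓ + 1) ((((((0 : ℤ) : ℝ) + 1 / 2 : ℝ) : ℂ) + (y : ℂ) * I) + 1)) =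
      fun y : ℝ => ((sechSq y : ℝ) : ℂ) * barnesP (ℓ + 1) (((1 / 2 : ℝ) : ℂ) + (y : ℂ) * I) +
        ((sechSq y : ℝ) : ℂ) * barnesP ℓ (((1 / 2 : ℝ) : ℂ) + (y : ℂ) * I) := by
    funext y
    have hp : (((((0 : ℤ) : ℝ) + 1 / 2 : ℝ) : ℂ) + (y : ℂ) * I) + 1 =
        (((1 / 2 : ℝ) : ℂ) + (y : ℂ) * I) + 1 := by
      push_cast
      ring
    rw [hp, barnesP_pascal]
    ring
  rw [eL, eR, integral_add (integrable_kernelMoment (ℓ + 1)) (integrable_kernelMoment ℓ), Int.cast_zero,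
    (hasDerivAt_barnesP_succ_shift ℓ).deriv] at step
  unfold kernelMoment
  linear_combination (-1 : ℂ) * step

/-- **[Zudilin2014ZetaTwo, Lemma 1]** in kernel form on the line `Re t = ½`:
`(1/2π) ∫_ℝ (π/sin π(½+iy))² P_ℓ(½+iy) dy = (−1)^ℓ/(ℓ+1)` — i.e.
`(1/2πi)∫_{½−i∞}^{½+i∞} (π/sin πt)² (t−1)⋯(t−ℓ)/ℓ! dt = (−1)^ℓ/(ℓ+1)` (`dt = i dy`). -/
theorem barnes_lemma_one (ℓ : ℕ) :
    (1 / (2 * Real.pi) : ℂ) * ∫ y : ℝ, ((Real.pi : ℂ) / Complex.sin (Real.pi * (((1 / 2 : ℝ) : ℂ) + (y : ℂ) * I))) ^ 2 *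
        barnesP ℓ (((1 / 2 : ℝ) : ℂ) + (y : ℂ) * I) = (-1) ^ ℓ / (ℓ + 1) := by
  have hcos : Real.cos (Real.pi * (1 / 2)) = 0 := by
    rw [show Real.pi * (1 / 2) = Real.pi / 2 by ring, Real.cos_pi_div_two]
  have k : ∀ y : ℝ, ((Real.pi : ℂ) / Complex.sin (Real.pi * (((1 / 2 : ℝ) : ℂ) + (y : ℂ) * I))) ^ 2 =
      ((sechSq y : ℝ) : ℂ) := fun y => kernel_halfLine hcos y
  simp only [k]
  have h := kernelMoment_eq ℓ
  unfold kernelMoment at h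
  rw [h]
  have hπ : (Real.pi : ℂ) ≠ 0 := by exact_mod_cast Real.pi_ne_zero
  field_simp

end Summit.KontsevichZagierPeriods.Zeta5Search.Denom.KernelBinomialMoment

end
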